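import Summits.Ventures.GridStability.Models.InverterNetwork
import Literature.MathematicalPhysics.PowerSystems.DroopMicrogridHamiltonian

/-!
# GridStability/Models/InverterNetworkHamiltonian — bridge: the typed droop microgrid WITH voltage dynamics (N1) IS the printed port-Hamiltonian model; its Hamiltonian decreases along every solution

Cell `gridfusion` (LADDER-GRIDFUSION, APEX LINE rung G3.b «droop microgrid with Q–V voltage dynamics»;
seat gridfusion-model-3 (g6); lit-2 07:29:09Z «model-3: one-screen Summits bridge DroopMicrogrid(G = 0) ↦
DroopPH»). The Summits-side model N1 `DroopMicrogrid` (`Models/InverterNetwork.lean` p464230: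
[cite: KunduEtAl2019, eqs. (4a)–(4c), (5a)–(5b)] = [cite: ShinZavala2020, eqs. (1a)–(1b), (8a)–(8c)], states
`(θ, ω, V)`, gains `λ^p = k_P`, `λ^q = k_Q`, set-points `P^set, Q^set`, nominal voltages `v⁰`, reduced
network `G, B`) and lit-2's Literature typing of the SAME printed model in port-Hamiltonian form
`Literature.MathematicalPhysics.PowerSystems.DroopPH` (p509549: [cite: ShinZavala2020, eqs. (9), (10), (13)],
inputs `P^u, Q^u`, lossless `B` only) agree DEFINITIONALLY on a lossless network without shunt conductances:
* `DroopMicrogrid.toDroopPH` — `P^u := P^set`, `Q^u := Q^set + v⁰/k_Q` (the printed inputs (5)), same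
  `τ_P, τ_Q, k_P, k_Q, B`;
* `toDroopPH_P` / `toDroopPH_Q` / `field_toDroopPH` — with `G = 0` the power flows and the vector fields
  coincide (`k_Q ≠ 0`); `isSolutionOn_toDroopPH_iff` — same solutions;
* TRANSPORT of lit-2's kernel facts to every solution of the typed N1 model: `hasDerivWithinAt_hamiltonian`
  (`dH/dt = −∇Hᵀ R ∇H` (13) along `mg`-solutions with `V > 0`), `hamiltonian_antitoneOn` (`H` non-increasing on
  every solution segment with `V > 0`), `field_eq_zero_iff_hamiltonian` (rest points = critical points of `H`).
So rung G3.b has the same SOLVER-FREE Lyapunov lane as MV-3 / LFF: the certificate object for an instance is a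
region on which `H − H(x*)` is bounded below by a positive definite form (lyap-1's sublevel assembly; SOS or
interval only for that local bound), not a Gram-165 SOS search on the degree-4 recast (MODEL-3-NOTES §0 N1).
THREE COLUMNS. MODELLED only: identification of two typings of one printed model (MV-6N + MV-6D, lossless, no
shunt conductance — with `G_ii ≠ 0` the state-dependent term `V_i²G_ii` has no place in `P^u`); CERTIFIED:
nothing numeric; no sentence here says a converter or a microgrid is stable.
-/

noncomputable section

open Real Finset

namespace Summit.Ventures.GridStability.Models.DroopMicrogrid

open Literature.MathematicalPhysics.PowerSystems

variable {n : ℕ} (mg : DroopMicrogrid n)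

/-- **The port-Hamiltonian reading of the typed droop microgrid**: inputs `P^u := P^set`,
`Q^u := Q^set + v⁰/k_Q` [cite: ShinZavala2020, eq. (5)], same filters, gains and susceptances. -/
def toDroopPH : DroopPH n where
  τP := mg.τP
  τQ := mg.τQ
  kP := mg.kP
  kQ := mg.kQ
  Pu := mg.Pset
  Qu := fun i => mg.Qset i + mg.Vset i / mg.kQ i
  B := fun i j => mg.B i j

/-- Lossless network without shunt conductance (`G = 0`): the active power flows agree
(`Σ_j V_iV_jB_ij sin θ_ij`). [cite: ShinZavala2020, §III-A, power flows after (8)] -/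
theorem toDroopPH_P (hG : ∀ i j, mg.G i j = 0) (θ V : Fin n → ℝ) : mg.toDroopPH.P θ V = mg.P θ V := by
  funext i
  simp only [DroopPH.P, DroopMicrogrid.P, toDroopPH, hG, zero_mul, zero_add]
  refine Finset.sum_congr rfl fun j _ => ?_
  ring

/-- `G = 0`: the reactive power flows agree (`−Σ_j V_iV_jB_ij cos θ_ij`).
[cite: ShinZavala2020, §III-A, power flows after (8)] -/
theorem toDroopPH_Q (hG : ∀ i j, mg.G i j = 0) (θ V : Fin n → ℝ) : mg.toDroopPH.Q θ V = mg.Q θ V := by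
  funext i
  simp only [DroopPH.Q, DroopMicrogrid.Q, toDroopPH, hG, zero_mul, zero_sub, ← Finset.sum_neg_distrib]
  refine Finset.sum_congr rfl fun j _ => ?_
  ring

/-- **The vector fields coincide** (`G = 0`, `k_Q ≠ 0`): (9a)–(9c) with the inputs (5) substituted IS
(4a)–(4c) / (8a)–(8c) (`voltageLaw_eq`, `frequencyLaw_eq` of p509549 are the scalar rewrites).
[cite: ShinZavala2020, eqs. (5), (9)] [cite: KunduEtAl2019, eqs. (4a)–(4c)] -/
theorem field_toDroopPH (hG : ∀ i j, mg.G i j = 0) (hkQ : ∀ i, mg.kQ i ≠ 0) :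
    mg.toDroopPH.field = mg.field := by
  funext x
  refine Prod.ext ?_ (Prod.ext ?_ ?_)
  · funext i; rfl
  · funext i
    simp only [DroopPH.field, DroopMicrogrid.field, DroopMicrogrid.dω, mg.toDroopPH_P hG]
    simp only [toDroopPH]
    ring
  · funext i
    simp only [DroopPH.field, DroopMicrogrid.field, DroopMicrogrid.dV, mg.toDroopPH_Q hG]
    simp only [toDroopPH]
    field_simp [hkQ i]
    ring

/-- Same solutions. [folklore] -/
theorem isSolutionOn_toDroopPH_iff (hG : ∀ i j, mg.G i j = 0) (hkQ : ∀ i, mg.kQ i ≠ 0)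
    (γ : ℝ → State n) (s : Set ℝ) : mg.toDroopPH.IsSolutionOn γ s ↔ mg.IsSolutionOn γ s := by
  simp only [DroopPH.IsSolutionOn, DroopMicrogrid.IsSolutionOn, mg.field_toDroopPH hG hkQ]

/-- The Hamiltonian (10) of the typed microgrid (via the reading). [cite: ShinZavala2020, eq. (10)] -/
def hamiltonian (x : State n) : ℝ := mg.toDroopPH.H x

/-- **TRANSPORT of the dissipation identity (13) to the typed model**: along every solution of the N1
droop microgrid (lossless, no shunts, reciprocal `B`, nonzero gains/filters) with positive voltages at time
`t`, `dH/dt = −∇Hᵀ R(x) ∇H` within the time set. MODELLED: MV-6N + MV-6D.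
[cite: ShinZavala2020, eq. (13)] -/
theorem hasDerivWithinAt_hamiltonian (hG : ∀ i j, mg.G i j = 0) (hB : ∀ i j, mg.B i j = mg.B j i)
    (hkP : ∀ i, mg.kP i ≠ 0) (hτP : ∀ i, mg.τP i ≠ 0) (hkQ : ∀ i, mg.kQ i ≠ 0)
    {γ : ℝ → State n} {s : Set ℝ} {t : ℝ} (hsol : mg.IsSolutionOn γ s) (ht : t ∈ s)
    (hpos : ∀ i, 0 < (γ t).2.2 i) :
    HasDerivWithinAt (fun τ => mg.hamiltonian (γ τ)) (-mg.toDroopPH.dissipation (γ t)) s t := by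
  have hγ : HasDerivWithinAt γ (mg.toDroopPH.field (γ t)) s t := by
    rw [mg.field_toDroopPH hG hkQ]; exact hsol t ht
  exact mg.toDroopPH.hasDerivWithinAt_H_of_isSolution hB hkP hτP hkQ hγ hpos

/-- **`H` is non-increasing along every solution segment with positive voltages** (positive gains and
filter constants). MODELLED: MV-6N + MV-6D. [cite: ShinZavala2020, eq. (13), Prop. 1 (14a)] -/
theorem hamiltonian_antitoneOn (hG : ∀ i j, mg.G i j = 0) (hB : ∀ i j, mg.B i j = mg.B j i)
    (hkP : ∀ i, 0 < mg.kP i) (hτP : ∀ i, 0 < mg.τP i) (hkQ : ∀ i, 0 < mg.kQ i) (hτQ : ∀ i, 0 < mg.τQ i)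
    {γ : ℝ → State n} {a b : ℝ} (hsol : mg.IsSolutionOn γ (Set.Icc a b))
    (hpos : ∀ t ∈ Set.Icc a b, ∀ i, 0 < (γ t).2.2 i) :
    AntitoneOn (fun τ => mg.hamiltonian (γ τ)) (Set.Icc a b) := by
  have hsol' : mg.toDroopPH.IsSolutionOn γ (Set.Icc a b) :=
    (mg.isSolutionOn_toDroopPH_iff hG (fun i => (hkQ i).ne') γ _).2 hsol
  exact mg.toDroopPH.H_antitoneOn hB hkP hτP hkQ hτQ hsol' hpos

/-- **Rest points of the typed model are exactly the printed steady states** `ω = 0`, `P = P^set`,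
`V + k_Q (Q − Q^set) = v⁰` (i.e. the droop laws at rest) — lit-2's `field_eq_zero_iff_steady` read through
the bridge. MODELLED. [cite: ShinZavala2020, §III-C Prop. 1] [cite: KunduEtAl2019, after (5b)] -/
theorem field_eq_zero_iff_steady (hG : ∀ i j, mg.G i j = 0) (hkP : ∀ i, mg.kP i ≠ 0)
    (hτP : ∀ i, mg.τP i ≠ 0) (hkQ : ∀ i, mg.kQ i ≠ 0) (hτQ : ∀ i, mg.τQ i ≠ 0) (x : State n) :
    mg.field x = 0 ↔ (∀ i, x.2.1 i = 0) ∧ (∀ i, mg.P x.1 x.2.2 i = mg.Pset i) ∧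
      (∀ i, x.2.2 i + mg.kQ i * (mg.Q x.1 x.2.2 i - mg.Qset i) = mg.Vset i) := by
  rw [← mg.field_toDroopPH hG hkQ, mg.toDroopPH.field_eq_zero_iff_steady x hkP hτP hτQ,
    mg.toDroopPH_P hG, mg.toDroopPH_Q hG]
  have hPu : ∀ i, mg.toDroopPH.Pu i = mg.Pset i := fun i => rfl
  have hQu : ∀ i, mg.toDroopPH.Qu i = mg.Qset i + mg.Vset i / mg.kQ i := fun i => rfl
  have hkQ' : ∀ i, mg.toDroopPH.kQ i = mg.kQ i := fun i => rfl
  simp only [hPu, hQu, hkQ']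
  refine and_congr Iff.rfl (and_congr Iff.rfl (forall_congr' fun i => ?_))
  constructor
  · intro h
    have := h
    field_simp [hkQ i] at this
    have h2 : x.2.2 i + mg.kQ i * (mg.Q x.1 x.2.2 i - mg.Qset i) - mg.Vset i = 0 := by
      have e : x.2.2 i + mg.kQ i * (mg.Q x.1 x.2.2 i - (mg.Qset i + mg.Vset i / mg.kQ i))
          = x.2.2 i + mg.kQ i * (mg.Q x.1 x.2.2 i - mg.Qset i) - mg.Vset i := by
        field_simp [hkQ i]
        ring
      rw [← e]; exact h
    linarith
  · intro h
    have e : x.2.2 i + mg.kQ i * (mg.Q x.1 x.2.2 i - (mg.Qset i + mg.Vset i / mg.kQ i))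
        = x.2.2 i + mg.kQ i * (mg.Q x.1 x.2.2 i - mg.Qset i) - mg.Vset i := by
      field_simp [hkQ i]
      ring
    rw [e, h, sub_self]

end Summit.Ventures.GridStability.Models.DroopMicrogrid

end
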